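import Summits.BirchSwinnertonDyer.BirchSwinnertonDyer.Theorems.PAdicOrderV2PadicBSDrankLevelZero

/-!
# Crux `PAdicOrderPadicBSDrankR2` (stmt-BirchSwinnertonDyer-0490), line `Sketch` — stub LZT:
# the level `ord_{T=0} L_p(E,T) = 0` is the same at every good ordinary prime

Registered stub `stub_padicBSDrank_levelZeroTransfer` of the skeleton
`Cruxes/PAdicOrderPadicBSDrankR2/Lines/Sketch.lean` (v5). For `E/ℚ` (globally minimal `W`), two
primes `p`, `q` of good ordinary reduction (`2` allowed) and the newform `f` of `E`, with
`L_p(E,T) = padicLFunction f (unitRoot W p) ∈ ℚ_p⟦T⟧`: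

  `ord_{T=0} L_q(E,T) = 0  ⇒  ord_{T=0} L_p(E,T) = 0`  (and conversely, by symmetry).

Both sides read `L(E,1) ≠ 0` through the PROVED interpolation theorem
`L_q(E,0) = (1 - α_q⁻¹)² L(E,1)/Ω⁺_f` with `1 - α_q⁻¹ ≠ 0` (a good prime is never exceptional) and
`Ω⁺_f > 0`: `levelZero_order_padicLFunction_eq_zero_iff` (`Theorems/PAdicOrderV2PadicBSDrankLevelZero`,
p97204). In the v5 composition this closes RANK ZERO AT `p = 2` from the odd-prime items: there the
items give `ord_T L_{p'} = rank = 0` at an odd good ordinary `p'`, which transfers to `ord_T L_2 = 0`.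
Mazur–Tate–Teitelbaum, Invent. Math. 84 (1986), §I.14, (14.3) (interpolation at the trivial
character; `p = 2` included, `α` the unit root).
-/

-- D-0017: single-problem summit, so `Summit.BirchSwinnertonDyer.BirchSwinnertonDyer.…` repeats a
-- namespace BY DESIGN.
set_option linter.dupNamespace false

namespace Summit.BirchSwinnertonDyer.BirchSwinnertonDyer.Theorems

open scoped MatrixGroups ModularForm
open CongruenceSubgroup Literature.NumberTheory.EllipticCurves
  Literature.NumberTheory.EllipticCurves.ModularForms

/-- **The level `ord_{T=0} L_p(E,T) = 0` does not depend on the good ordinary prime `p`**: for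
`E/ℚ` (globally minimal `W`), good ordinary primes `p`, `q` and the newform `f` of `E`,
`ord_{T=0} L_p(E,T) = 0 ↔ ord_{T=0} L_q(E,T) = 0`, both being equivalent to `L(E,1) ≠ 0` by the
interpolation formula `L_p(E,0) = (1 - α_p⁻¹)² L(E,1)/Ω⁺_f`, `α_p ≠ 1`
(`levelZero_order_padicLFunction_eq_zero_iff`). [cite: MazurTateTeitelbaum1986Invent, §I.14 (14.3)] -/
theorem levelZero_order_eq_zero_iff_of_isOrdinaryAt (W : WeierstrassCurve ℚ) [W.IsElliptic]
    [W.IsGloballyMinimal] (p : ℕ) [Fact p.Prime] (hp : IsOrdinaryAt W p) (q : ℕ) [Fact q.Prime]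
    (hq : IsOrdinaryAt W q) {N : ℕ} [NeZero N] {f : CuspForm (Gamma0 N) 2} (hf : IsNewformOf W f) :
    (padicLFunction f (unitRoot W p : ℚ_[p])).order = 0 ↔
      (padicLFunction f (unitRoot W q : ℚ_[q])).order = 0 :=
  (levelZero_order_padicLFunction_eq_zero_iff W p hp hf).trans
    (levelZero_order_padicLFunction_eq_zero_iff W q hq hf).symm

/-- **Stub LZT of line `Sketch` (crux #3 `PAdicOrderPadicBSDrankR2`, stmt-0490): level-zero
transfer.** For `E/ℚ` (globally minimal `W`), good ordinary primes `p`, `q` (`2` allowed) and the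
newform `f` of `E`: `ord_{T=0} L_q(E,T) = 0 ⇒ ord_{T=0} L_p(E,T) = 0` — both read `L(E,1) ≠ 0`
(`levelZero_order_eq_zero_iff_of_isOrdinaryAt`). [cite: MazurTateTeitelbaum1986Invent, §I.14 (14.3)] -/
theorem stub_padicBSDrank_levelZeroTransfer :
    ∀ (W : WeierstrassCurve ℚ) [W.IsElliptic] [W.IsGloballyMinimal] (p : ℕ) [Fact p.Prime],
      IsOrdinaryAt W p → ∀ (q : ℕ) [Fact q.Prime], IsOrdinaryAt W q →
      ∀ {N : ℕ} [NeZero N] (f : CuspForm (Gamma0 N) 2), IsNewformOf W f →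
      (padicLFunction f (unitRoot W q : ℚ_[q])).order = 0 →
      (padicLFunction f (unitRoot W p : ℚ_[p])).order = 0 :=
  fun W _ _ p _ hp q _ hq _ _ _ hf h ↦ (levelZero_order_eq_zero_iff_of_isOrdinaryAt W p hp q hq hf).mpr h

end Summit.BirchSwinnertonDyer.BirchSwinnertonDyer.Theorems
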